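import Summits.QuantumAdvantage.AdviceFreeQNC0.OutHeavyStar
import Summits.QuantumAdvantage.AdviceFreeQNC0.SPSRingFail
import Summits.QuantumAdvantage.AdviceFreeQNC0.TensorMultAtUpperBound
import HarnessLib

/-!
# Cell qa-qnc0 (rung F-Q1, density axis): `StarOfOutHeavyButOne 4` is FALSE — the literal Lemma G′ of
# Sketch14 needs support concentration at the exceptional word (planner qa-qnc0-p1 gen 14, ask P19)

`StarOfOutHeavyButOne m := ∀ K0 c, OutHeavyButOne m K0 c → StarCert m K0` (Sketch14 §OutHeavy, statement
VERBATIM in `OutHeavyStar.lean`) quantifies over ALL patterns `K0`.  But (★) forces SC₁ at every codeword: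
with `s ≡ 0` the column test at `X = 0` gives `q ≡ 0` on `Z`, and then at `X = c` it gives
`|supp c ∩ Z| ≤ |supp c ∖ Z|`; `OutHeavyButOne` does not supply this for the exceptional word `c` itself.
Smallest witness (`m = 4`; found by a 1-second search, `cert/star_witness.py`): `c` = the unique minimum word
of `C_4`, `supp c = {0000, 1111}`, and `Z := supp c` (`K0 = ¬c`): every other non-zero codeword has `≥ 2 = |Z|`
points outside `Z` (checked over the `2^{10}` codewords via the affine normal form), while
`|supp c ∩ Z| = 2 > 0 = |supp c ∖ Z|`.

* `not_starOfOutHeavyButOne_four : ¬ StarOfOutHeavyButOne 4`.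

The REPAIRED lemma (`SC1At m K0 → OutHeavyButOne m K0 c → StarCert m K0`) is `starCert_of_outHeavyButOne`
(`OutHeavyStarMain.lean`); the m = 8 chain is unaffected (it runs at optimal `K0`, where SC₁ holds).
WHAT THIS IS NOT: nothing about `StarOfOutHeavyButOne 8` specifically (the same recipe — a 30-subset of a
minimum word's support — is expected to refute it, but needs the m = 8 minimum-word data); separation NOT moved.
-/

namespace Summit.QuantumAdvantage.AdviceFreeQNC0

open Finset
open MassInequality

namespace StarRefute

/-- The exceptional codeword of `C_4`: the indicator of `{0000, 1111}` (`T₀ = T₁ = 1 ⊕ parity`, `T₂ = 0`). -/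
def c4 (u : Fin 4 → Bool) : Bool := decide (wt u = 0 ∨ wt u = 4)

/-- `K0 := ¬ c4`, i.e. `Z(K0) = supp c4`. -/
def K4 (u : Fin 4 → Bool) : Bool := !c4 u

/-- The affine triple behind `c4`. -/
def T4 (r : ℕ) (u : Fin 4 → Bool) : Bool :=
  if r = 2 then false else !decide (wt u % 2 = 1)

/-- Codeword pattern of an affine pair (the normal form of `IsElim1`). -/
def pat {m : ℕ} (ℓ₀ ℓ₁ : Finset (Fin m) × Bool) (u : Fin m → Bool) : Bool :=
  if wt u % 3 = 0 then affEval ℓ₀ u else if wt u % 3 = 1 then affEval ℓ₁ u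
  else xor (affEval ℓ₀ u) (affEval ℓ₁ u)

/-- Every codeword is the pattern of an affine pair. -/
theorem exists_pat {m : ℕ} {Y : (Fin m → Bool) → Bool} (hY : IsElim1 m Y) :
    ∃ ℓ₀ ℓ₁ : Finset (Fin m) × Bool, Y = pat ℓ₀ ℓ₁ := by
  obtain ⟨T, hT, hTe, hTY⟩ := hY
  obtain ⟨ℓ₀, h₀⟩ := SPSRingFail.exists_affEval_of_hasDeg_one (hT 0)
  obtain ⟨ℓ₁, h₁⟩ := SPSRingFail.exists_affEval_of_hasDeg_one (hT 1)
  refine ⟨ℓ₀, ℓ₁, funext fun u => ?_⟩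
  rw [hTY u]
  unfold pat
  have h3 : wt u % 3 < 3 := Nat.mod_lt _ (by norm_num)
  rcases (by omega : wt u % 3 = 0 ∨ wt u % 3 = 1 ∨ wt u % 3 = 2) with h | h | h
  · rw [h, if_pos rfl, h₀]
  · rw [h, if_neg (by norm_num), if_pos rfl, h₁]
  · rw [h, if_neg (by norm_num), if_neg (by norm_num), ← h₀, ← h₁]
    have := hTe u
    revert this
    cases T 0 u <;> cases T 1 u <;> cases T 2 u <;> decide

/-- The `𝔽₂`-degree of `1 ⊕ parity` is `≤ 1`. -/
theorem hasDeg_T4 (r : ℕ) : HasDeg (T4 r) 1 := by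
  unfold T4
  by_cases hr : r = 2
  · simp only [hr, if_true]; exact TensorUB.hasDeg_const false
  · simp only [hr, if_false]
    have h : (fun u : Fin 4 → Bool => !decide (wt u % 2 = 1)) = fun u => xor true (TensorUB.par u) := by
      funext u; unfold TensorUB.par; cases decide (wt u % 2 = 1) <;> rfl
    rw [h]
    exact hasDeg_xor (TensorUB.hasDeg_const true) TensorUB.hasDeg_par

/-- `c4` is a codeword. -/
theorem isElim1_c4 : IsElim1 4 c4 := by
  refine ⟨T4, hasDeg_T4, fun u => ?_, fun u => ?_⟩
  · revert u; decide
  · revert u; decide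

/-- The finite check: every non-zero codeword of `C_4` other than `c4` has at least two points outside `supp c4`. -/
theorem outHeavy_check :
    ∀ ℓ₀ ℓ₁ : Finset (Fin 4) × Bool, pwt (pat ℓ₀ ℓ₁) ≠ 0 → pat ℓ₀ ℓ₁ ≠ c4 →
      failCount K4 ≤ MassInequality.outCount K4 (pat ℓ₀ ℓ₁) := by
  unfold pwt failCount MassInequality.outCount
  decide +kernel

/-- `OutHeavyButOne 4 K4 c4`. -/
theorem outHeavyButOne_four : OutHeavyButOne 4 K4 c4 := by
  refine ⟨isElim1_c4, fun Y hY hw hne => ?_⟩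
  obtain ⟨ℓ₀, ℓ₁, rfl⟩ := exists_pat hY
  exact outHeavy_check ℓ₀ ℓ₁ hw hne

/-- `StarCert 4 K4` fails: (★) with `s ≡ 0` forces `q ≡ 0` on `Z` (test `X = 0`) and then
`|supp c4 ∩ Z| ≤ |supp c4 ∖ Z| = 0` (test `X = c4`), but `|supp c4 ∩ Z| = 2`. -/
theorem not_starCert_four : ¬ StarCert 4 K4 := by
  intro h
  obtain ⟨q, hq01, htest⟩ := h (fun _ => false)
  -- test at `X = 0`: `q ≡ 0` on `Z`
  have h0 := htest (fun _ => false) (isElim1_false 4)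
  have hrhs0' : (univ.filter fun u : Fin 4 → Bool => K4 u = true ∧ (fun _ : Fin 4 → Bool => false) u ≠ false).card = 0 := by
    rw [Finset.card_eq_zero, filter_eq_empty_iff]; intro u _ h; exact h.2 rfl
  have hrhs0 : ((univ.filter fun u : Fin 4 → Bool => K4 u = true ∧ (fun _ : Fin 4 → Bool => false) u ≠ false).card : ℚ) = 0 := by
    rw [hrhs0', Nat.cast_zero]
  rw [hrhs0] at h0
  have hq0 : ∀ z ∈ univ.filter (fun z : Fin 4 → Bool => K4 z = false), q z = 0 := by
    have hnn : ∀ z ∈ univ.filter (fun z : Fin 4 → Bool => K4 z = false), 0 ≤ |bq false - q z| :=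
      fun z _ => abs_nonneg _
    have hz := (sum_eq_zero_iff_of_nonneg hnn).1 (le_antisymm h0 (sum_nonneg hnn))
    intro z hz'
    have := hz z hz'
    simpa [bq] using this
  -- test at `X = c4`
  have hc := htest c4 isElim1_c4
  have hterm : ∀ z ∈ univ.filter (fun z : Fin 4 → Bool => K4 z = false), |bq (c4 z) - q z| = 1 := by
    intro z hz
    have hcz : c4 z = true := by
      have h' := (mem_filter.1 hz).2
      revert h'; unfold K4; cases c4 z <;> simp
    rw [hq0 z hz, hcz]; simp [bq]
  have hlhs : (∑ z ∈ univ.filter (fun z : Fin 4 → Bool => K4 z = false), |bq (c4 z) - q z|) =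
      ((univ.filter fun z : Fin 4 → Bool => K4 z = false).card : ℚ) := by
    rw [sum_congr rfl hterm, sum_const, nsmul_eq_mul, mul_one]
  have hrhs' : (univ.filter fun u : Fin 4 → Bool => K4 u = true ∧ c4 u ≠ (fun _ : Fin 4 → Bool => false) u).card = 0 := by
    rw [Finset.card_eq_zero, filter_eq_empty_iff]
    intro u _ h
    obtain ⟨h1, h2⟩ := h
    revert h1 h2; unfold K4; cases c4 u <;> simp
  have hrhs : ((univ.filter fun u : Fin 4 → Bool => K4 u = true ∧ c4 u ≠ (fun _ : Fin 4 → Bool => false) u).card : ℚ) = 0 := by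
    rw [hrhs', Nat.cast_zero]
  have hcard : (univ.filter fun z : Fin 4 → Bool => K4 z = false).card = 2 := by decide
  rw [hlhs, hrhs, hcard] at hc
  norm_num at hc

end StarRefute

/-- **`StarOfOutHeavyButOne 4` is false** (the literal Lemma G′ of Sketch14 over all `K0`). -/
theorem not_starOfOutHeavyButOne_four : ¬ StarOfOutHeavyButOne 4 :=
  fun h => StarRefute.not_starCert_four (h _ _ StarRefute.outHeavyButOne_four)

end Summit.QuantumAdvantage.AdviceFreeQNC0
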